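import Summits.AtomisticToContinuum.Crystallization.Theorems.ChessboardParticlePlanesPeriodicWindowsGapSqueezeCompetitor2
import Summits.AtomisticToContinuum.Crystallization.Theorems.PhononSlackCertificatesPeriodicGivenLayeredLayerCake3

/-!
# Crux `PeriodicWindows` (stmt-AtomisticToContinuum-3240), line `dense-laminar-hull` — helper W7 `hc_compressedHeights`
# (competitor data of HC `stub_hollowClosing`; lead c12)

(1) Compressed heights with an arbitrary threshold `t ≥ 3/4`: given heights `z` with gaps `≥ 3/4` there is `z' : ℤ → ℝ` with
`z' 0 = 0` and increments `min (z (m+1) - z m) t`; it is strictly increasing, its gaps lie in `[3/4, t]`, its block increments are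
at most those of `z` and at least `3/4` per layer (the generalisation of `gsc_exists_sq` / `gsc_sq_block`, where `t = 1`).
(2) EVERY general layered set `B '' {i v₁(a) + j v₂(a) + δ m + z m e₃}` with `a ≥ 7/10`, horizontal offsets and gaps `≥ 3/4`
is `7/10`-separated: same-layer distances are `≥ a` (a nonzero vector of the triangular lattice has norm `≥ a`), cross-layer
distances are `≥` the height difference `≥ 3/4`. [folklore]
-/

noncomputable section

namespace Summit.AtomisticToContinuum.Crystallization.Theorems.PeriodicWindowsDenseLaminarHull

open Literature.MathematicalPhysics.StatisticalMechanics Filter Metric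
open scoped BigOperators

/-! ## Compressed heights with threshold `t` -/

/-- Existence of heights with `z' 0 = 0` and increments `min (z (m+1) - z m) t` (partial sums upwards and downwards from `0`).
[folklore] -/
theorem hch_exists (z : ℤ → ℝ) (t : ℝ) :
    ∃ z' : ℤ → ℝ, z' 0 = 0 ∧ ∀ m : ℤ, z' (m + 1) - z' m = min (z (m + 1) - z m) t := by
  set up : ℕ → ℝ := fun n => ∑ k ∈ Finset.range n, min (z ((k : ℤ) + 1) - z (k : ℤ)) t with hup
  set dn : ℕ → ℝ := fun n => ∑ k ∈ Finset.range n, min (z (-(k : ℤ)) - z (-(k : ℤ) - 1)) t with hdn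
  refine ⟨fun m => if 0 ≤ m then up m.toNat else -dn (-m).toNat, by simp [hup], fun m => ?_⟩
  have hup_succ : ∀ n : ℕ, up (n + 1) - up n = min (z ((n : ℤ) + 1) - z (n : ℤ)) t := fun n => by
    simp only [hup, Finset.sum_range_succ]; ring
  have hdn_succ : ∀ n : ℕ, dn (n + 1) - dn n = min (z (-(n : ℤ)) - z (-(n : ℤ) - 1)) t := fun n => by
    simp only [hdn, Finset.sum_range_succ]; ring
  rcases lt_trichotomy m (-1) with hm | rfl | hm
  · have h1 : ¬ (0 ≤ m + 1) := by omega
    have h2 : ¬ (0 ≤ m) := by omega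
    simp only [h1, h2, if_false]
    obtain ⟨n, hn⟩ : ∃ n : ℕ, (-(m + 1)).toNat = n := ⟨_, rfl⟩
    have hn' : (-m).toNat = n + 1 := by omega
    have hmn : (n : ℤ) = -(m + 1) := by omega
    rw [hn, hn', show -dn n - -dn (n + 1) = dn (n + 1) - dn n by ring, hdn_succ n, hmn]
    congr 2 <;> congr 1 <;> ring
  · simp only [show (-1 : ℤ) + 1 = 0 by norm_num, le_refl, if_true, Int.toNat_zero,
      show ¬ ((0 : ℤ) ≤ -1) by norm_num, if_false, sub_neg_eq_add]
    have : up 0 = 0 := by simp [hup]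
    rw [this, zero_add, show (-(-1 : ℤ)).toNat = 0 + 1 by norm_num, ← sub_zero (dn (0 + 1)),
      show (0 : ℝ) = dn 0 by simp [hdn], hdn_succ 0]
    norm_num
  · have h1 : 0 ≤ m + 1 := by omega
    have h2 : 0 ≤ m := by omega
    simp only [h1, h2, if_true]
    obtain ⟨n, hn⟩ : ∃ n : ℕ, m.toNat = n := ⟨_, rfl⟩
    have hn' : (m + 1).toNat = n + 1 := by omega
    have hmn : (n : ℤ) = m := by omega
    rw [hn, hn', hup_succ n, hmn]

/-- Block increments of the `t`-compressed heights (`t ≥ 3/4`, gaps of `z` at least `3/4`): over `n` layers the compressed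
increment is at most the original one and at least `3n/4`. [folklore] -/
theorem hch_block (z z' : ℤ → ℝ) (t : ℝ) (ht : (3 : ℝ) / 4 ≤ t) (hgap : ∀ m : ℤ, (3 : ℝ) / 4 ≤ z (m + 1) - z m)
    (hz' : ∀ m : ℤ, z' (m + 1) - z' m = min (z (m + 1) - z m) t) (m : ℤ) (n : ℕ) :
    z' (m + n) - z' m ≤ z (m + n) - z m ∧ (3 : ℝ) / 4 * n ≤ z' (m + n) - z' m := by
  induction n with
  | zero => simp
  | succ n ih =>
    obtain ⟨h1, h2⟩ := ih
    have e1 : z' (m + ((n + 1 : ℕ) : ℤ)) - z' m = (z' (m + n) - z' m) + (z' (m + n + 1) - z' (m + n)) := by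
      push_cast; ring
    have e2 : z (m + ((n + 1 : ℕ) : ℤ)) - z m = (z (m + n) - z m) + (z (m + n + 1) - z (m + n)) := by
      push_cast; ring
    have hstep := hz' (m + n)
    have hmin : (3 : ℝ) / 4 ≤ min (z (m + n + 1) - z (m + n)) t := le_min (hgap (m + n)) ht
    refine ⟨?_, ?_⟩
    · rw [e1, e2, hstep]
      linarith [min_le_left (z (m + n + 1) - z (m + n)) t]
    · rw [e1, hstep]
      push_cast
      linarith

/-- Gaps `≥ 3/4` accumulate: `(3/4) n ≤ z (m + n) - z m`. [folklore] -/
theorem hch_accumulate {z : ℤ → ℝ} (hgap : ∀ m : ℤ, (3 : ℝ) / 4 ≤ z (m + 1) - z m) (m : ℤ) (n : ℕ) :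
    (3 : ℝ) / 4 * n ≤ z (m + n) - z m := by
  induction n with
  | zero => simp
  | succ n ih =>
    have h1 := hgap (m + n)
    rw [add_assoc] at h1
    push_cast
    linarith

/-! ## Separation of a general layered set -/

/-- A nonzero vector of the triangular lattice of spacing `a ≥ 0` has norm `≥ a`. [folklore] -/
theorem hch_lattice_norm {a : ℝ} (ha : 0 ≤ a) {i j : ℤ} (hij : (i, j) ≠ 0) :
    a ≤ ‖(i : ℝ) • triangularVec₁ a + (j : ℝ) • triangularVec₂ a‖ := by
  have h := LayeredHull.cake_le_norm_layerVec_inLayer a ha hij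
  rwa [LayeredHull.cake_layerVec_height_zero] at h

/-- **Separation**: a general layered set with `a ≥ 7/10`, horizontal offsets, strictly increasing heights and gaps `≥ 3/4`
is `7/10`-separated. [folklore] -/
theorem hch_separated {a : ℝ} (ha : (7 : ℝ) / 10 ≤ a) {B : EuclideanSpace ℝ (Fin 3) ≃ₗᵢ[ℝ] EuclideanSpace ℝ (Fin 3)}
    {δ : ℤ → EuclideanSpace ℝ (Fin 3)} {z : ℤ → ℝ} (hB : ∀ p : EuclideanSpace ℝ (Fin 3), (B p) 2 = p 2)
    (hδ : ∀ m : ℤ, (δ m) 2 = 0) (hz : StrictMono z) (hgap : ∀ m : ℤ, (3 : ℝ) / 4 ≤ z (m + 1) - z m)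
    {S : Set (EuclideanSpace ℝ (Fin 3))}
    (hS : S = (fun p => B p) '' {p | ∃ m i j : ℤ, p = ((i : ℝ) • triangularVec₁ a) +
      ((j : ℝ) • triangularVec₂ a) + δ m + (z m • layerNormal 1)}) :
    ∀ p ∈ S, ∀ q ∈ S, p ≠ q → (7 : ℝ) / 10 ≤ dist p q := by
  have ha0 : 0 < a := by linarith
  have hinj := gsc_param_injective (a := a) ha0 hB hδ hz.injective
  have hrange := gsc_range_param (a := a) B δ z
  rw [← hS] at hrange
  intro p hp q hq hpq
  rw [← hrange] at hp hq
  obtain ⟨⟨m, i, j⟩, rfl⟩ := hp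
  obtain ⟨⟨m', i', j'⟩, rfl⟩ := hq
  dsimp only at hpq ⊢
  have e1 := gsc_dist_sq (a := a) (B := B) hδ m m' (i : ℝ) j i' j' (z m) (z m')
  by_cases hm : m = m'
  · subst hm
    have hij : (i - i', j - j') ≠ (0 : ℤ × ℤ) := by
      intro h
      rw [Prod.ext_iff] at h
      obtain ⟨h1, h2⟩ := h
      simp only [Prod.fst_zero, Prod.snd_zero, sub_eq_zero] at h1 h2
      exact hpq (by rw [h1, h2])
    have hn := hch_lattice_norm ha0.le hij
    push_cast at hn
    have e2 : dist (B (((i : ℝ)) • triangularVec₁ a + ((j : ℝ)) • triangularVec₂ a + δ m +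
        z m • layerNormal 1)) (B (((i' : ℝ)) • triangularVec₁ a + ((j' : ℝ)) • triangularVec₂ a + δ m +
        z m • layerNormal 1)) ^ 2 = ‖((i : ℝ) - i') • triangularVec₁ a + ((j : ℝ) - j') • triangularVec₂ a‖ ^ 2 := by
      rw [e1, sub_self, sub_self, add_zero]; ring
    have hd : a ^ 2 ≤ dist (B (((i : ℝ)) • triangularVec₁ a + ((j : ℝ)) • triangularVec₂ a + δ m +
        z m • layerNormal 1)) (B (((i' : ℝ)) • triangularVec₁ a + ((j' : ℝ)) • triangularVec₂ a + δ m +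
        z m • layerNormal 1)) ^ 2 := by
      rw [e2]
      exact pow_le_pow_left₀ ha0.le hn 2
    have h' := (pow_le_pow_iff_left₀ ha0.le dist_nonneg two_ne_zero).1 hd
    linarith
  · have h34 : (3 : ℝ) / 4 ≤ |z m - z m'| := by
      rcases lt_or_gt_of_ne hm with hlt | hlt
      · obtain ⟨n, hn⟩ : ∃ n : ℕ, m' = m + n := ⟨(m' - m).toNat, by omega⟩
        subst hn
        have hn1 : (1 : ℝ) ≤ n := by exact_mod_cast (show 1 ≤ n by omega)
        have hb := hch_accumulate hgap m n
        rw [abs_sub_comm, abs_of_nonneg (by linarith)]; linarith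
      · obtain ⟨n, hn⟩ : ∃ n : ℕ, m = m' + n := ⟨(m - m').toNat, by omega⟩
        subst hn
        have hn1 : (1 : ℝ) ≤ n := by exact_mod_cast (show 1 ≤ n by omega)
        have hb := hch_accumulate hgap m' n
        rw [abs_of_nonneg (by linarith)]; linarith
    have hsq : ((3 : ℝ) / 4) ^ 2 ≤ (z m - z m') ^ 2 := by
      rw [← sq_abs (z m - z m')]; exact pow_le_pow_left₀ (by norm_num) h34 2
    have hd : ((3 : ℝ) / 4) ^ 2 ≤ dist (B (((i : ℝ)) • triangularVec₁ a + ((j : ℝ)) • triangularVec₂ a + δ m +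
        z m • layerNormal 1)) (B (((i' : ℝ)) • triangularVec₁ a + ((j' : ℝ)) • triangularVec₂ a + δ m' +
        z m' • layerNormal 1)) ^ 2 := by
      rw [e1]
      nlinarith [norm_nonneg (((i : ℝ) - i') • triangularVec₁ a + ((j : ℝ) - j') • triangularVec₂ a +
        (δ m - δ m'))]
    have h34' := (pow_le_pow_iff_left₀ (by norm_num) dist_nonneg two_ne_zero).1 hd
    linarith

/-! ## The registered helper -/

/-- **W7 `hc_compressedHeights`** (competitor data of HC): (1) `t`-compressed heights (`t ≥ 3/4`) exist with `z' 0 = 0`,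
increments `min(gap, t)`, strictly increasing, gaps in `[3/4, t]`, block increments at most those of `z` and at least `3/4` per
layer; (2) every general layered set with `a ≥ 7/10`, horizontal offsets, strictly increasing heights with gaps `≥ 3/4` is
`7/10`-separated. [folklore] -/
theorem hc_compressedHeights : (∀ (z : ℤ → ℝ) (t : ℝ), (3 : ℝ) / 4 ≤ t → (∀ m : ℤ, (3 : ℝ) / 4 ≤ z (m + 1) - z m) →
    ∃ z' : ℤ → ℝ, z' 0 = 0 ∧ (∀ m : ℤ, z' (m + 1) - z' m = min (z (m + 1) - z m) t) ∧ StrictMono z' ∧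
      (∀ m : ℤ, (3 : ℝ) / 4 ≤ z' (m + 1) - z' m) ∧ (∀ m : ℤ, z' (m + 1) - z' m ≤ t) ∧
      (∀ m m' : ℤ, m ≤ m' → z' m' - z' m ≤ z m' - z m) ∧
      (∀ m m' : ℤ, m ≤ m' → (3 : ℝ) / 4 * ((m' : ℝ) - m) ≤ z' m' - z' m)) ∧
    (∀ a : ℝ, (7 : ℝ) / 10 ≤ a →
      ∀ (B : EuclideanSpace ℝ (Fin 3) ≃ₗᵢ[ℝ] EuclideanSpace ℝ (Fin 3)) (δ : ℤ → EuclideanSpace ℝ (Fin 3)) (z : ℤ → ℝ),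
      (∀ p : EuclideanSpace ℝ (Fin 3), (B p) 2 = p 2) → (∀ m : ℤ, (δ m) 2 = 0) → StrictMono z →
      (∀ m : ℤ, (3 : ℝ) / 4 ≤ z (m + 1) - z m) →
      ∀ S : Set (EuclideanSpace ℝ (Fin 3)), S = (fun p => B p) '' {p | ∃ m i j : ℤ, p = ((i : ℝ) • triangularVec₁ a) +
        ((j : ℝ) • triangularVec₂ a) + δ m + (z m • layerNormal 1)} →
      ∀ p ∈ S, ∀ q ∈ S, p ≠ q → (7 : ℝ) / 10 ≤ dist p q) := by
  refine ⟨fun z t ht hgap => ?_, fun a ha B δ z hB hδ hz hgap S hS => hch_separated ha hB hδ hz hgap hS⟩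
  obtain ⟨z', hz'0, hz'⟩ := hch_exists z t
  have hgap' : ∀ m : ℤ, (3 : ℝ) / 4 ≤ z' (m + 1) - z' m := fun m => by
    rw [hz' m]; exact le_min (hgap m) ht
  have hmono : StrictMono z' := strictMono_int_of_lt_succ fun m => by linarith [hgap' m]
  refine ⟨z', hz'0, hz', hmono, hgap', fun m => by rw [hz' m]; exact min_le_right _ _, fun m m' hmm' => ?_,
    fun m m' hmm' => ?_⟩
  · obtain ⟨n, rfl⟩ : ∃ n : ℕ, m' = m + n := ⟨(m' - m).toNat, by omega⟩
    exact (hch_block z z' t ht hgap hz' m n).1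
  · obtain ⟨n, rfl⟩ : ∃ n : ℕ, m' = m + n := ⟨(m' - m).toNat, by omega⟩
    have h := (hch_block z z' t ht hgap hz' m n).2
    push_cast
    linarith

end Summit.AtomisticToContinuum.Crystallization.Theorems.PeriodicWindowsDenseLaminarHull

end
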